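import Summits.ABC.ABC.Theses.IneffectiveSubspace
import Summits.ABC.ABC.Theorems.IneffectiveSubspaceAbcGivesTower

/-!
# `UniformSadicTowerFour` (stmt-ABC-14937), line `Sketch`: mixed-radical normal form at `S` ⟹ crux at `S`

The stub `stub_tower_of_mixed_at` of the line `Sketch` (card `mixed-radical-exchange-map`).

**Statement.** Fix `C, ε > 0` and a finite set `S ⊆ ℕ`. Suppose the MIXED inequality holds at `S` for
every abc triple `(a, b, c)`: `c < C · M_S(abc)^(1+ε)`, where
`M_S(m) := (∏_{p ∈ S} p) · ∏_{p ∣ m, p ∉ S} p^⌈v_p(m)/4⌉` and `⌈v/4⌉` is written `(v+3)/4`. Then the crux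
inequality with the same `C, ε, S` holds for every positive coprime level-4 tower point: for all
`x y z : Fin 4 → ℕ` with all entries positive, `a + b = c` and `Coprime a b`, where `a := ∏ xᵢ^(i+1)`,
`b := ∏ yᵢ^(i+1)`, `c := ∏ zᵢ^(i+1)`, one has `c < C · ((∏_{p ∈ S} p) · {M}^S)^(1+ε)` with
`M := ∏ xᵢyᵢzᵢ` and `{M}^S := ∏_{p ∣ M, p ∉ S} p^{v_p(M)}` the `S`-free part.

**Proof.** `(a, b, c)` is an abc triple (positivity of `a, b` from positivity of the entries), so the
hypothesis gives `c < C · M_S(abc)^(1+ε)`, and it remains to prove the natural-number inequality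
`M_S(abc) ≤ (∏_{p ∈ S} p) · {M}^S` and use monotonicity of `t ↦ C · t^(1+ε)` (`C ≥ 0`, `1 + ε ≥ 0`).
Write `mᵢ := xᵢyᵢzᵢ`; then `abc = ∏ᵢ mᵢ^(i+1)` (`AbcGivesTower.prod_pow_mul_three`) and `M = ∏ᵢ mᵢ`,
so for every `p`
`v_p(abc) = Σᵢ (i+1)·v_p(mᵢ)` and `v_p(M) = Σᵢ v_p(mᵢ)`, whence
`v_p(M) ≤ v_p(abc) ≤ 4·v_p(M)` (`1 ≤ i+1 ≤ 4` on `Fin 4`). Consequently `abc` and `M` have the same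
prime factors, and `⌈v_p(abc)/4⌉ ≤ v_p(M)`; the two products run over the same index set
`primeFactors \ S` and compare termwise (`p ≥ 1`). No primality of the elements of `S` and no
coprimality is used for this direction.

Sources: card mixed-radical-exchange-map (crux stmt-ABC-14937, line Sketch). The tree lemma
`AbcGivesTower.prod_pow_mul_three` (`Theorems/IneffectiveSubspaceAbcGivesTower.lean`) and Mathlib only
(`Nat.factorization_prod`, `Nat.factorization_pow`, `Nat.support_factorization`, `Finset.prod_le_prod'`,
`Nat.pow_le_pow_right`, `Real.rpow_le_rpow`). Deliberately NOT here: the converse direction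
(neighbouring stub `stub_mixed_of_tower_at`) and the other stubs of the line.
-/

-- `Summit.<Summit>.<Problem>` is the mandated summit-side namespace (CONVENTIONS §2); for the
-- single-conjunct summit `ABC` the two coincide, so the duplicate `ABC.ABC` is deliberate.
set_option linter.dupNamespace false

namespace Summit.ABC.ABC.Theorems.UniformSadicTowerFour.MixedRadical

open Literature.NumberTheory.DiophantineGeometry (IsABCTriple rad rad_def)
open Summit.ABC.ABC.Theses.IneffectiveSubspace
open scoped BigOperators

/-- **Valuation of a tower product.** For nonzero `mᵢ`, `v_p(∏ᵢ mᵢ^(i+1)) = Σᵢ (i+1)·v_p(mᵢ)`.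
[folklore] -/
theorem towerOfMixed_factorization_prod_pow {n : ℕ} (m : Fin n → ℕ) (hm : ∀ i, m i ≠ 0) (p : ℕ) :
    (∏ i, m i ^ (i.val + 1)).factorization p = ∑ i, (i.val + 1) * (m i).factorization p := by
  rw [Nat.factorization_prod fun i _ => pow_ne_zero _ (hm i), Finsupp.finsetSum_apply]
  refine Finset.sum_congr rfl fun i _ => ?_
  rw [Nat.factorization_pow, Finsupp.smul_apply, smul_eq_mul]

/-- **Valuation of a plain product.** For nonzero `mᵢ`, `v_p(∏ᵢ mᵢ) = Σᵢ v_p(mᵢ)`. [folklore] -/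
theorem towerOfMixed_factorization_prod {n : ℕ} (m : Fin n → ℕ) (hm : ∀ i, m i ≠ 0) (p : ℕ) :
    (∏ i, m i).factorization p = ∑ i, (m i).factorization p := by
  rw [Nat.factorization_prod fun i _ => hm i, Finsupp.finsetSum_apply]

/-- **The level-4 valuation sandwich.** For nonzero `m : Fin 4 → ℕ` and every `p`,
`v_p(∏ mᵢ) ≤ v_p(∏ mᵢ^(i+1)) ≤ 4 · v_p(∏ mᵢ)` (since `1 ≤ i+1 ≤ 4`). [folklore] -/
theorem towerOfMixed_factorization_bounds (m : Fin 4 → ℕ) (hm : ∀ i, m i ≠ 0) (p : ℕ) :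
    (∏ i, m i).factorization p ≤ (∏ i, m i ^ (i.val + 1)).factorization p ∧
      (∏ i, m i ^ (i.val + 1)).factorization p ≤ 4 * (∏ i, m i).factorization p := by
  rw [towerOfMixed_factorization_prod_pow m hm, towerOfMixed_factorization_prod m hm, Finset.mul_sum]
  exact ⟨Finset.sum_le_sum fun i _ => Nat.le_mul_of_pos_left _ (Nat.succ_pos _),
    Finset.sum_le_sum fun i _ => Nat.mul_le_mul_right _ i.isLt⟩

/-- **Mixed radical ≤ `S`-adic bracket.** For a positive level-4 tower point and any finite `S ⊆ ℕ`,
`M_S(abc) = (∏_{p ∈ S} p) · ∏_{p ∣ abc, p ∉ S} p^⌈v_p(abc)/4⌉ ≤ (∏_{p ∈ S} p) · ∏_{p ∣ M, p ∉ S} p^{v_p(M)}`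
with `M = ∏ xᵢyᵢzᵢ`: `abc` and `M` have the same prime factors and `⌈v_p(abc)/4⌉ ≤ v_p(M)`.
[folklore] -/
theorem towerOfMixed_mixed_le_sadic (x y z : Fin 4 → ℕ) (hpos : ∀ i, 0 < x i ∧ 0 < y i ∧ 0 < z i)
    (S : Finset ℕ) :
    (∏ p ∈ S, p) * ∏ p ∈ ((∏ i, x i ^ (i.val + 1)) * (∏ i, y i ^ (i.val + 1)) *
        (∏ i, z i ^ (i.val + 1))).primeFactors \ S,
      p ^ ((((∏ i, x i ^ (i.val + 1)) * (∏ i, y i ^ (i.val + 1)) *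
        (∏ i, z i ^ (i.val + 1))).factorization p + 3) / 4) ≤
    (∏ p ∈ S, p) * ∏ p ∈ (∏ i, x i * y i * z i).primeFactors \ S,
      p ^ (∏ i, x i * y i * z i).factorization p := by
  have hm : ∀ i, x i * y i * z i ≠ 0 := fun i =>
    (Nat.mul_pos (Nat.mul_pos (hpos i).1 (hpos i).2.1) (hpos i).2.2).ne'
  have hb := towerOfMixed_factorization_bounds (fun i => x i * y i * z i) hm
  rw [AbcGivesTower.prod_pow_mul_three]
  -- `abc` and `M` have the same prime factors
  have hpf : (∏ i, (x i * y i * z i) ^ (i.val + 1)).primeFactors =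
      (∏ i, x i * y i * z i).primeFactors := by
    ext p
    rw [← Nat.support_factorization, ← Nat.support_factorization, Finsupp.mem_support_iff,
      Finsupp.mem_support_iff]
    obtain ⟨h1, h2⟩ := hb p
    constructor <;> intro h <;> omega
  rw [hpf]
  refine Nat.mul_le_mul_left _ (Finset.prod_le_prod' fun p hp => ?_)
  refine Nat.pow_le_pow_right (Nat.pos_of_mem_primeFactors (Finset.mem_sdiff.mp hp).1) ?_
  obtain ⟨-, h2⟩ := hb p
  omega

/-- **stub_tower_of_mixed_at (normal form ⟹ crux, one `S` at a time).** If the mixed inequality with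
constant `C` and exponent `1+ε` holds at `S` for every abc triple, then the crux inequality with the same
`C, ε, S` holds for every positive coprime level-4 tower point: with `a = ∏ xᵢ^(i+1)` etc. and
`M = ∏ xᵢyᵢzᵢ`, `abc` and `M` have the same prime factors and `⌈v_p(abc)/4⌉ ≤ v_p(M)`
(`v_p(abc) = Σ (i+1)·v_p(xᵢyᵢzᵢ) ≤ 4·v_p(M)`), so `M_S(abc) ≤ (∏_{p∈S} p) · {M}^S`
(`towerOfMixed_mixed_le_sadic`), and `t ↦ C · t^(1+ε)` is monotone. [folklore] -/
theorem stub_tower_of_mixed_at {C ε : ℝ} (hC : 0 < C) (hε : 0 < ε) {S : Finset ℕ}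
    (h : ∀ a b c : ℕ, IsABCTriple a b c →
      (c : ℝ) < C * ((((∏ p ∈ S, p) *
        ∏ p ∈ (a * b * c).primeFactors \ S, p ^ (((a * b * c).factorization p + 3) / 4) : ℕ) : ℝ)) ^
          (1 + ε)) :
    ∀ x y z : Fin 4 → ℕ, (∀ i, 0 < x i ∧ 0 < y i ∧ 0 < z i) →
      (∏ i, x i ^ (i.val + 1)) + (∏ i, y i ^ (i.val + 1)) = ∏ i, z i ^ (i.val + 1) →
      Nat.Coprime (∏ i, x i ^ (i.val + 1)) (∏ i, y i ^ (i.val + 1)) →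
      ((∏ i, z i ^ (i.val + 1) : ℕ) : ℝ) < C * (((∏ p ∈ S, p) *
        ∏ p ∈ (∏ i, x i * y i * z i).primeFactors \ S, p ^ (∏ i, x i * y i * z i).factorization p : ℕ) :
          ℝ) ^ (1 + ε) := by
  intro x y z hpos hsum hcop
  have ha : 0 < ∏ i, x i ^ (i.val + 1) := Finset.prod_pos fun i _ => pow_pos (hpos i).1 _
  have hb : 0 < ∏ i, y i ^ (i.val + 1) := Finset.prod_pos fun i _ => pow_pos (hpos i).2.1 _
  have hle : ((((∏ p ∈ S, p) * ∏ p ∈ ((∏ i, x i ^ (i.val + 1)) * (∏ i, y i ^ (i.val + 1)) *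
        (∏ i, z i ^ (i.val + 1))).primeFactors \ S,
      p ^ ((((∏ i, x i ^ (i.val + 1)) * (∏ i, y i ^ (i.val + 1)) *
        (∏ i, z i ^ (i.val + 1))).factorization p + 3) / 4) : ℕ) : ℝ)) ≤
      (((∏ p ∈ S, p) * ∏ p ∈ (∏ i, x i * y i * z i).primeFactors \ S,
        p ^ (∏ i, x i * y i * z i).factorization p : ℕ) : ℝ) := by
    exact_mod_cast towerOfMixed_mixed_le_sadic x y z hpos S
  calc ((∏ i, z i ^ (i.val + 1) : ℕ) : ℝ)
      < C * ((((∏ p ∈ S, p) * ∏ p ∈ ((∏ i, x i ^ (i.val + 1)) * (∏ i, y i ^ (i.val + 1)) *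
          (∏ i, z i ^ (i.val + 1))).primeFactors \ S,
        p ^ ((((∏ i, x i ^ (i.val + 1)) * (∏ i, y i ^ (i.val + 1)) *
          (∏ i, z i ^ (i.val + 1))).factorization p + 3) / 4) : ℕ) : ℝ)) ^ (1 + ε) :=
        h _ _ _ ⟨ha, hb, hsum, hcop⟩
    _ ≤ C * (((∏ p ∈ S, p) * ∏ p ∈ (∏ i, x i * y i * z i).primeFactors \ S,
          p ^ (∏ i, x i * y i * z i).factorization p : ℕ) : ℝ) ^ (1 + ε) := by
        apply mul_le_mul_of_nonneg_left _ hC.le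
        exact Real.rpow_le_rpow (by positivity) hle (by linarith)

end Summit.ABC.ABC.Theorems.UniformSadicTowerFour.MixedRadical
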